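import Summits.QuantumAdvantage.QuantumAdvantage.Theorems.FlatDialRigid
import Summits.QuantumAdvantage.QuantumAdvantage.Theorems.FlatDialCubeKey

/-!
# FlatDialMCert — module 9 of the lens-3 g11 «FlatDial» THEOREMS package (cell decomp-qadv): what a valid `M`-certificate of a framed cube-key MM function spans

Module 5 (`FlatDial.validMCerts`, in tree) types `M`-certificates `c = (t, rows, x*)`; module 8 (`msubspace_unique_cubeMM`) says the cube-key MM function
`cubeMM r` has the unique `M`-subspace `{z = 0}`.  This module draws the consequence the `W_M` recovery argument (record §12 (c)–(d)) needs, for a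
planted function `y ↦ cubeMM r (A y)` under an arbitrary ADDITIVE frame `A : Equiv.Perm (Fin (r*3 + r*3) → Bool)`:

* §1 generic facts on spans of certificates: `span_add`, `certRow_mem_span`, `card_span`, `span_dillon` (a valid `M`-certificate's span satisfies the
  Dillon condition), and the transport of the three hypotheses of Lemma U along an additive bijection (`image_add`, `image_dillon`);
* §2 ★★ `span_eq_framePreimage` : for EVERY valid `M`-certificate `c` of `cubeMM r ∘ A`, `span c = A⁻¹{z = 0}` — membership form `mem_span_iff_frame`, row
  form `frame_certRow_z`.  So the rows found by ANY `M`-certificate finder present the SAME subspace `L = A⁻¹{z = 0}`; the extractor of §12 (d) reads it.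

ZERO `def X : Prop`.  Provenance: HOME/decomp-qadv-lens-3/g11/ (record NODE-g11.md §12, LAND-g11.md step 9).
-/

set_option linter.dupNamespace false

namespace Summit.QuantumAdvantage.QuantumAdvantage.Theorems.FlatDial

open Finset
open Literature.Computability.QuantumComplexity
open Literature.Computability.QuantumComplexity.BuzetChailloux (bxor zeroVec)
open Summit.QuantumAdvantage.QuantumAdvantage.Theorems.HintDial.Automaton (bd sgl bd_sgl_left)

/-! ## 1. Spans of certificates; transport along an additive bijection -/

section Generic

variable {n : ℕ}

/-- the span of a certificate is closed under `⊕`. -/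
theorem span_add (c : CertIdx n → Bool) : ∀ u ∈ span c, ∀ v ∈ span c, bxor u v ∈ span c := by
  intro u hu v hv
  obtain ⟨a, -, rfl⟩ := mem_image.1 hu
  obtain ⟨a', -, rfl⟩ := mem_image.1 hv
  exact mem_image.2 ⟨bxor a a', mem_univ _, comb_bxor c a a'⟩

/-- row `k` is the combination with coefficient vector `e_k`. -/
theorem comb_sgl (c : CertIdx n → Bool) (k : Fin (n / 2)) : comb c (sgl k) = certRow c k := by
  funext i; exact bd_sgl_left k _

/-- every row lies in the span. -/
theorem certRow_mem_span (c : CertIdx n → Bool) (k : Fin (n / 2)) : certRow c k ∈ span c :=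
  mem_image.2 ⟨sgl k, mem_univ _, comb_sgl c k⟩

/-- independent rows span `2^{n/2}` points. -/
theorem card_span {c : CertIdx n → Bool} (hinj : Function.Injective (comb c)) : (span c).card = 2 ^ (n / 2) := by
  rw [span, card_image_of_injective _ hinj, card_univ, Fintype.card_fun, Fintype.card_bool, Fintype.card_fin]

/-- ★ a valid `M`-certificate's span satisfies the Dillon condition: all second derivatives of `G` along it vanish. -/
theorem span_dillon {G : (Fin n → Bool) → Bool} {c : CertIdx n → Bool} (hc : c ∈ validMCerts G) :
    ∀ u ∈ span c, ∀ v ∈ span c, ∀ y,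
      xor (xor (G (bxor (bxor y u) v)) (G (bxor y u))) (xor (G (bxor y v)) (G y)) = false := by
  intro u hu v hv y
  obtain ⟨a, -, rfl⟩ := mem_image.1 hu
  obtain ⟨b, -, rfl⟩ := mem_image.1 hv
  exact hc.2 a b y

variable {m : ℕ}

/-- closure under `⊕` is transported along an additive map. -/
theorem image_add (A : (Fin n → Bool) → (Fin m → Bool)) (hA : ∀ x y, A (bxor x y) = bxor (A x) (A y))
    {V : Finset (Fin n → Bool)} (hV : ∀ u ∈ V, ∀ v ∈ V, bxor u v ∈ V) :
    ∀ u' ∈ V.image A, ∀ v' ∈ V.image A, bxor u' v' ∈ V.image A := by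
  classical
  intro u' hu' v' hv'
  obtain ⟨u, hu, rfl⟩ := mem_image.1 hu'
  obtain ⟨v, hv, rfl⟩ := mem_image.1 hv'
  exact mem_image.2 ⟨bxor u v, hV u hu v hv, hA u v⟩

/-- ★ the Dillon condition of `G ∘ A` along `V` is the Dillon condition of `G` along `A(V)`, for an additive bijection `A`. -/
theorem image_dillon (A : Equiv.Perm (Fin n → Bool)) (hA : ∀ x y, A (bxor x y) = bxor (A x) (A y))
    (G : (Fin n → Bool) → Bool) {V : Finset (Fin n → Bool)}
    (hV : ∀ u ∈ V, ∀ v ∈ V, ∀ y,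
      xor (xor (G (A (bxor (bxor y u) v))) (G (A (bxor y u)))) (xor (G (A (bxor y v))) (G (A y))) = false) :
    ∀ u' ∈ V.image A, ∀ v' ∈ V.image A, ∀ y',
      xor (xor (G (bxor (bxor y' u') v')) (G (bxor y' u'))) (xor (G (bxor y' v')) (G y')) = false := by
  classical
  intro u' hu' v' hv' y'
  obtain ⟨u, hu, rfl⟩ := mem_image.1 hu'
  obtain ⟨v, hv, rfl⟩ := mem_image.1 hv'
  obtain ⟨y, rfl⟩ := A.surjective y'
  have h := hV u hu v hv y
  simp only [hA] at h
  exact h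

end Generic

/-! ## 2. Valid `M`-certificates of a framed cube-key MM function -/

section Framed

variable {r : ℕ}

/-- ★ the image under the frame of a valid `M`-certificate's span is `{z = 0}` (Lemma U, module 8). -/
theorem image_span_eq {A : Equiv.Perm (Fin (r * 3 + r * 3) → Bool)}
    (hA : ∀ x y, A (bxor x y) = bxor (A x) (A y)) {c : CertIdx (r * 3 + r * 3) → Bool} (hc : c ∈ validMCerts fun y => cubeMM r (A y)) :
    (span c).image A = univ.filter fun y => ∀ i, y (Fin.natAdd (r * 3) i) = false := by
  classical
  refine msubspace_unique_cubeMM _ (image_add A hA (span_add c)) (image_dillon A hA (cubeMM r) (span_dillon hc)) ?_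
  rw [card_image_of_injective _ A.injective, card_span hc.1.1]
  have h1 : (r * 3 + r * 3) / 2 = 3 * r := by omega
  rw [h1, pow_mul]; norm_num

/-- ★★ EVERY valid `M`-certificate of the framed function spans the SAME subspace `A⁻¹{z = 0}`: membership form. -/
theorem mem_span_iff_frame {A : Equiv.Perm (Fin (r * 3 + r * 3) → Bool)}
    (hA : ∀ x y, A (bxor x y) = bxor (A x) (A y)) {c : CertIdx (r * 3 + r * 3) → Bool} (hc : c ∈ validMCerts fun y => cubeMM r (A y))
    (y : Fin (r * 3 + r * 3) → Bool) : y ∈ span c ↔ ∀ i, A y (Fin.natAdd (r * 3) i) = false := by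
  classical
  have key := image_span_eq hA hc
  constructor
  · intro hy
    have h : A y ∈ (span c).image A := mem_image_of_mem A hy
    rw [key] at h
    exact (mem_filter.1 h).2
  · intro hy
    have h : A y ∈ (span c).image A := by rw [key]; exact mem_filter.2 ⟨mem_univ _, hy⟩
    obtain ⟨y', hy', he⟩ := mem_image.1 h
    exact A.injective he ▸ hy'

/-- set form: `span c = A⁻¹{z = 0}`. -/
theorem span_eq_framePreimage {A : Equiv.Perm (Fin (r * 3 + r * 3) → Bool)}
    (hA : ∀ x y, A (bxor x y) = bxor (A x) (A y)) {c : CertIdx (r * 3 + r * 3) → Bool} (hc : c ∈ validMCerts fun y => cubeMM r (A y)) :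
    span c = univ.filter fun y => ∀ i, A y (Fin.natAdd (r * 3) i) = false := by
  classical
  ext y
  rw [mem_span_iff_frame hA hc, mem_filter]
  exact ⟨fun h => ⟨mem_univ _, h⟩, fun h => h.2⟩

/-- row form: the frame maps every certified row into `{z = 0}`. -/
theorem frame_certRow_z {A : Equiv.Perm (Fin (r * 3 + r * 3) → Bool)}
    (hA : ∀ x y, A (bxor x y) = bxor (A x) (A y)) {c : CertIdx (r * 3 + r * 3) → Bool} (hc : c ∈ validMCerts fun y => cubeMM r (A y))
    (k : Fin ((r * 3 + r * 3) / 2)) (i : Fin (r * 3)) : A (certRow c k) (Fin.natAdd (r * 3) i) = false :=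
  (mem_span_iff_frame hA hc _).1 (certRow_mem_span c k) i

/-- conversely, every point of `A⁻¹{z = 0}` is a combination of the certified rows. -/
theorem exists_comb_of_frame_z {A : Equiv.Perm (Fin (r * 3 + r * 3) → Bool)}
    (hA : ∀ x y, A (bxor x y) = bxor (A x) (A y)) {c : CertIdx (r * 3 + r * 3) → Bool} (hc : c ∈ validMCerts fun y => cubeMM r (A y))
    {y : Fin (r * 3 + r * 3) → Bool} (hy : ∀ i, A y (Fin.natAdd (r * 3) i) = false) :
    ∃ a : Fin ((r * 3 + r * 3) / 2) → Bool, comb c a = y := by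
  classical
  obtain ⟨a, -, ha⟩ := mem_image.1 ((mem_span_iff_frame hA hc y).2 hy)
  exact ⟨a, ha⟩

end Framed

end Summit.QuantumAdvantage.QuantumAdvantage.Theorems.FlatDial
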